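import Summits.BirchSwinnertonDyer.Rank1Residual.AdditivePotMult.NonPrimitiveMuTransferOdd
import HarnessLib

/-!
# `Sel_{p^∞}(E₂/ℚ_∞)` is `Λ`-COTORSION with `μ = 0` as soon as the congruent partner's non-primitive
# Selmer group has finite `p`-torsion — the PRIMITIVE consequence of the GV transfer count at every
# odd additive prime of the four loci, mod `hGrK` (A239) / A40–A41
# (cell `b2b-bsdres`, team n1011, seat p12 (gen 5); row T-E3g-GV29o FILE 6; ROUTE-2 II.15.4 ARM α)

HONEST FRAMING (cell `b2b-bsdres`, run/shared/lean/b2b/bsd-rank1-residual/, verbatim in every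
file): the goal of the cell is to DELETE the COMBINATION-SHAPED residual classes of the
Birch–Swinnerton-Dyer formula for ALL analytic-rank `≤ 1` elliptic curves over `ℚ` — "full BSD
formula for every rank `≤ 1` curve in class `C`" assembled STRICTLY from published theorems — so
that the rank-`≤ 1` remainder becomes exactly the CONSTRUCTION-SHAPED classes, which are TYPED
(missing-input `Prop`s), NOT attempted. This is not "finishing BSD". Team n1011: research routes on
CONSTRUCTION-SHAPED classes; prove what is provable now; no claim beyond stated classes; census
output = EVIDENCE, never a Literature fact; RESIDUAL-MAP marks UNCHANGED; nothing is booked by this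
file. THEOREMS ONLY: no definition, no named fact; eisenstein-p2's `X2.SelmerCotorsionOfFiniteTorsion`
/ `X2.MuTransferDerived` algebra and the `SelmerDualData` API are consumed BY NAME and untouched.

## What and why

Greenberg LNM 1716 Prop. 5.10 (proof, PDF p. 147): "We will show that `Sel_E(ℚ_∞)[p]` is finite. This
obviously implies the conclusion" (`Sel_E(ℚ_∞)_p` `Λ`-cotorsion with `μ_E = 0`) — in the kernel as
eisenstein-p2's `isTorsion_and_exists_hasUnitContent_of_finite_torsionBy`. GV p. 27 transfers this
along a congruence through the NON-PRIMITIVE groups: `Sel_{E₂}(ℚ_∞)[p] ⊆ Sel^{Σ₀}_{E₂}(ℚ_∞)[p]`, and the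
latter is finite as soon as `Sel^{Σ₀}_{E₁}(ℚ_∞)[p]` is (FILE 3's equal counts), e.g. as soon as some
f.g. non-primitive dual of `E₁` is torsion with `μ = 0` (FILE 4). Hence, on every congruent pair of the
four loci, **`Sel_{p^∞}(E₂/ℚ_∞)` is `Λ`-cotorsion with `μ = 0`** — the structural input that the cell's
Route-G consumers on these rows otherwise take as the binders `D₂.IsTorsion` / `D₂.mu = 0`.

* §1 (any `E/ℚ`, `κ` cyclotomic with top generator `γ`, any `Σ₀`)
  `finite_torsionBy_selmerInfty_of_nonPrimitive`, `selmer_isTorsion_and_mu_eq_zero_of_finite_torsionBy_nonPrimitive`;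
  two curves `selmer_isTorsion_and_mu_eq_zero_of_natCard_eq`.
* §2 the four loci: `ClassX4Gord/ClassX3Gord.selmer_isTorsion_and_mu_eq_zero_of_torsionIso` (mod
  `hGrK`), `ClassX4M/ClassX3M.…` (mod A40/A41), mixed `ClassX4M.…_of_classX4Gord`,
  `ClassX3M.…_of_classX3Gord`: for EVERY Pontryagin-dual datum `D₂` of `Sel_{p^∞}(E₂/ℚ_∞)`,
  `D₂.IsTorsion ∧ D₂.mu = 0`, given a f.g. torsion non-primitive dual of `E₁` with `μ = 0`.

The `E₁`-side input stays NON-primitive (turning `μ(X₁) = 0` into `μ(X^{Σ₀}_1) = 0` is GV (7), not in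
the tree at additive `p`); no `λ`-statement here (FILE 5); nothing booked; X3♯/X4♯ stay as labelled.

References: [GreenbergVatsal2000] §2 Prop. (2.8), pp. 26–27; [GreenbergLNM1716] Prop. 5.10 (p. 147);
[Washington1997] §13.2; ROUTE-2 II.15.4.
-/

set_option autoImplicit false

noncomputable section

open scoped Classical NumberField AddSubgroup

open NumberField IsDedekindDomain Field WeierstrassCurve
  Literature.NumberTheory.GaloisRepresentations Literature.NumberTheory.EllipticCurves
  Literature.NumberTheory.EllipticCurves.GreenbergSelmer
  Literature.NumberTheory.EllipticCurves.GreenbergVatsal2000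
  Literature.NumberTheory.EllipticCurves.EmertonPollackWeston2006
  Literature.NumberTheory.EllipticCurves.Rank1Residual
  Literature.NumberTheory.EllipticCurves.Greenberg1999
  Summit.BirchSwinnertonDyer.Rank1Residual.X2.MuTransferDerived
  Summit.BirchSwinnertonDyer.Rank1Residual.X2.MuVanishingOfFiniteModP
  Summit.BirchSwinnertonDyer.Rank1Residual.X2.SelmerCotorsionOfFiniteTorsion

/-! ## §1. Algebra: finite `Sel^{Σ₀}[p]` ⟹ `Sel_{p^∞}(E/ℚ_∞)` cotorsion with `μ = 0` -/

namespace Summit.BirchSwinnertonDyer.Rank1Residual.Additive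

open Summit.BirchSwinnertonDyer.Rank1Residual.X1.CongruenceTransfer (TorsionIso)

section Algebra

variable {p : ℕ} [hp : Fact p.Prime] {W : WeierstrassCurve ℚ} [W.IsElliptic] (κ : ZpExtension ℚ p)
  {γ : absoluteGaloisGroup ℚ} (S₀ : Set (HeightOneSpectrum (𝓞 ℚ)))

omit [W.IsElliptic] in
/-- `Sel_{p^∞}(E/K_∞)[p] ↪ Sel^{Σ₀}_E(K_∞)_p[p]`: finiteness descends (GV (5): `Sel ⊆ Sel^{Σ₀}`).
[cite: GreenbergVatsal2000, §1 p. 7] -/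
theorem finite_torsionBy_selmerInfty_of_nonPrimitive [Finite ((nonPrimitiveSelmerInfty W κ S₀)[(p : ℤ)])] :
    Finite ((W.selmerInfty κ)[(p : ℤ)]) := by
  have hle := selmerInfty_le_nonPrimitiveSelmerInfty W κ S₀
  refine Finite.of_injective
    (fun x : (W.selmerInfty κ)[(p : ℤ)] ↦
      (⟨AddSubgroup.inclusion hle (x : W.selmerInfty κ), AddSubgroup.torsionBy.nsmul_iff.mpr (by
        rw [← map_nsmul, AddSubgroup.torsionBy.nsmul_iff.mp x.2, map_zero])⟩ :
        (nonPrimitiveSelmerInfty W κ S₀)[(p : ℤ)])) fun x y hxy ↦ ?_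
  have h := congrArg (fun z : (nonPrimitiveSelmerInfty W κ S₀)[(p : ℤ)] ↦
    ((z : nonPrimitiveSelmerInfty W κ S₀) : W.subgroupH1 p κ.kerSubgroup)) hxy
  exact Subtype.ext (Subtype.ext (by simpa using h))

/-- **Finite `Sel^{Σ₀}_E(ℚ_∞)_p[p]` ⟹ `Sel_{p^∞}(E/ℚ_∞)` is `Λ`-cotorsion with `μ = 0`** (every
Pontryagin-dual datum `D`; `κ` cyclotomic, `γ` a topological generator): Greenberg's "this obviously
implies the conclusion" (eisenstein-p2's `isTorsion_of_finite_modN` / `muInvariant_eq_zero_of_finite_modN'`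
on `X/pX ≅ Hom(Sel, ℚ/ℤ)/p`, finite since `Sel[p] ⊆ Sel^{Σ₀}[p]` is).
[cite: GreenbergLNM1716, Prop. 5.10 (proof, PDF p. 147)] [cite: GreenbergVatsal2000, §2 Prop. (2.8)] -/
theorem selmer_isTorsion_and_mu_eq_zero_of_finite_torsionBy_nonPrimitive (hκ : κ.IsCyclotomic)
    (hγ : κ.IsTopGenerator γ) (D : W.SelmerDualData κ γ)
    [Finite ((nonPrimitiveSelmerInfty W κ S₀)[(p : ℤ)])] : D.IsTorsion ∧ D.mu = 0 := by
  haveI : Finite ((W.selmerInfty κ)[(p : ℤ)]) := finite_torsionBy_selmerInfty_of_nonPrimitive κ S₀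
  haveI : Module.Finite (IwasawaAlgebra p) D.X :=
    SelmerDualData.module_finite_of_isCyclotomic (W := W) (κ := κ) hκ D hγ
  haveI : Finite (ModN (CharacterModule (W.selmerInfty κ)) p) :=
    finite_modN_characterModule_of_finite_torsionBy p (S := W.selmerInfty κ)
  let e : D.X ≃+ CharacterModule (W.selmerInfty κ) := AddEquiv.ofBijective D.toDual D.bijective
  haveI hfin : Finite (ModN D.X p) := Finite.of_equiv _ (modNEquiv e p).symm.toEquiv
  have htors : D.IsTorsion := isTorsion_of_finite_modN p D.X
  exact ⟨htors, muInvariant_eq_zero_of_finite_modN' p D.X htors hfin⟩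

end Algebra

section Transfer

variable {p : ℕ} [hp : Fact p.Prime] {W₁ W₂ : WeierstrassCurve ℚ} [W₂.IsElliptic]
  (κ : ZpExtension ℚ p) {γ : absoluteGaloisGroup ℚ} (S₀ : Set (HeightOneSpectrum (𝓞 ℚ)))

/-- **Transfer along an equality of counts, primitive conclusion**: if `#Sel^{Σ₀}_{E₁}[p] =
#Sel^{Σ₀}_{E₂}[p]` and some f.g. dual datum of `Sel^{Σ₀}_{E₁}` is torsion with `μ = 0`, then EVERY dual
datum of `Sel_{p^∞}(E₂/ℚ_∞)` is torsion with `μ = 0` (`κ` cyclotomic).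
[cite: GreenbergVatsal2000, §2 Prop. (2.8) and pp. 26–27] [cite: GreenbergLNM1716, Prop. 5.10 (proof, PDF p. 147)] -/
theorem selmer_isTorsion_and_mu_eq_zero_of_natCard_eq (hκ : κ.IsCyclotomic) (hγ : κ.IsTopGenerator γ)
    (hcount : Nat.card ((nonPrimitiveSelmerInfty W₁ κ S₀)[(p : ℤ)]) =
      Nat.card ((nonPrimitiveSelmerInfty W₂ κ S₀)[(p : ℤ)]))
    (DS₁ : NonPrimitiveDualData W₁ κ γ S₀) [Module.Finite (IwasawaAlgebra p) DS₁.X]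
    (ht₁ : Module.IsTorsion (IwasawaAlgebra p) DS₁.X) (hμ₁ : muInvariant p DS₁.X = 0)
    (D₂ : W₂.SelmerDualData κ γ) : D₂.IsTorsion ∧ D₂.mu = 0 := by
  haveI := finite_torsionBy_nonPrimitiveSelmerInfty_of_mu_eq_zero κ S₀ DS₁ ht₁ hμ₁
  have hne : Nat.card ((nonPrimitiveSelmerInfty W₂ κ S₀)[(p : ℤ)]) ≠ 0 := by
    rw [← hcount]
    exact Nat.card_pos.ne'
  haveI : Finite ((nonPrimitiveSelmerInfty W₂ κ S₀)[(p : ℤ)]) := Nat.finite_of_card_ne_zero hne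
  exact selmer_isTorsion_and_mu_eq_zero_of_finite_torsionBy_nonPrimitive κ S₀ hκ hγ D₂

end Transfer

/-! ## §2. The four loci -/

section Gord

variable {p : ℕ} [hp : Fact p.Prime] {W₁ W₂ : WeierstrassCurve ℚ} [W₁.IsElliptic]
  [W₁.IsGloballyMinimal] [W₂.IsElliptic] [W₂.IsGloballyMinimal] (κ : ZpExtension ℚ p)
  {γ : absoluteGaloisGroup ℚ} (S₀ : Set (HeightOneSpectrum (𝓞 ℚ)))

/-- **X4♯(G-ord, `e = 2`) pairs, every odd `p`: `Sel_{p^∞}(E₂/ℚ_∞)` is `Λ`-COTORSION with `μ = 0`**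
(every dual datum `D₂`) as soon as a f.g. non-primitive dual of the congruent partner `E₁` is torsion
with `μ = 0`; `κ` cyclotomic with top generator `γ`, `Σ₀ ∌ p ⊇` bad primes, `E₁[p] ≅ E₂[p]`; mod `hGrK`
(A239). X4♯ stays CONSTRUCTION-SHAPED; nothing booked. [cite: GreenbergVatsal2000, §2 Prop. (2.8) and pp. 26–27]
[cite: GreenbergLNM1716, §2 Prop. 2.4 (p. 80) and Prop. 5.10 (p. 147)] -/
theorem ClassX4Gord.selmer_isTorsion_and_mu_eq_zero_of_torsionIso
    (hGrK : imKummer_ge_strictCondition_goodOrdinary) (hκ : κ.IsCyclotomic) (hγ : κ.IsTopGenerator γ)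
    (hX₁ : ClassX4Gord W₁ p) (he₁ : semistabilityIndex W₁ p = 2)
    (hX₂ : ClassX4Gord W₂ p) (he₂ : semistabilityIndex W₂ p = 2)
    (hS₀ : ∀ v ∈ S₀, ((p : ℕ) : 𝓞 ℚ) ∉ v.asIdeal)
    (hS₁ : ∀ v : HeightOneSpectrum (𝓞 ℚ), v ∉ S₀ → ((p : ℕ) : 𝓞 ℚ) ∉ v.asIdeal →
      W₁.HasGoodReductionAt v)
    (hS₂ : ∀ v : HeightOneSpectrum (𝓞 ℚ), v ∉ S₀ → ((p : ℕ) : 𝓞 ℚ) ∉ v.asIdeal →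
      W₂.HasGoodReductionAt v)
    (hT : TorsionIso W₁ W₂ p)
    (DS₁ : NonPrimitiveDualData W₁ κ γ S₀) [Module.Finite (IwasawaAlgebra p) DS₁.X]
    (ht₁ : Module.IsTorsion (IwasawaAlgebra p) DS₁.X) (hμ₁ : muInvariant p DS₁.X = 0)
    (D₂ : W₂.SelmerDualData κ γ) : D₂.IsTorsion ∧ D₂.mu = 0 :=
  selmer_isTorsion_and_mu_eq_zero_of_natCard_eq κ S₀ hκ hγ
    (ClassX4Gord.natCard_torsionBy_nonPrimitiveSelmerInfty_eq κ S₀ hGrK hκ hX₁ he₁ hX₂ he₂ hS₀ hS₁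
      hS₂ hT) DS₁ ht₁ hμ₁ D₂

/-- **X3♯(G-ord, `e = 2`) pairs, odd `p` (REDUCIBLE `E_i[p]`): the same**, census bit
`p ∤ #E₁(ℚ)_tors`; mod `hGrK`. X3♯ stays as labelled; nothing booked.
[cite: GreenbergVatsal2000, §2 Prop. (2.8) and pp. 26–27] [cite: GreenbergLNM1716, §2 Prop. 2.4 (p. 80) and Prop. 5.10 (p. 147)] -/
theorem ClassX3Gord.selmer_isTorsion_and_mu_eq_zero_of_torsionIso
    (hGrK : imKummer_ge_strictCondition_goodOrdinary) (hp2 : p ≠ 2) (hκ : κ.IsCyclotomic)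
    (hγ : κ.IsTopGenerator γ)
    (hX₁ : ClassX3Gord W₁ p) (he₁ : semistabilityIndex W₁ p = 2)
    (hX₂ : ClassX3Gord W₂ p) (he₂ : semistabilityIndex W₂ p = 2)
    (htors₁ : ¬ p ∣ W₁.torsionOrder)
    (hS₀ : ∀ v ∈ S₀, ((p : ℕ) : 𝓞 ℚ) ∉ v.asIdeal)
    (hS₁ : ∀ v : HeightOneSpectrum (𝓞 ℚ), v ∉ S₀ → ((p : ℕ) : 𝓞 ℚ) ∉ v.asIdeal →
      W₁.HasGoodReductionAt v)
    (hS₂ : ∀ v : HeightOneSpectrum (𝓞 ℚ), v ∉ S₀ → ((p : ℕ) : 𝓞 ℚ) ∉ v.asIdeal →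
      W₂.HasGoodReductionAt v)
    (hT : TorsionIso W₁ W₂ p)
    (DS₁ : NonPrimitiveDualData W₁ κ γ S₀) [Module.Finite (IwasawaAlgebra p) DS₁.X]
    (ht₁ : Module.IsTorsion (IwasawaAlgebra p) DS₁.X) (hμ₁ : muInvariant p DS₁.X = 0)
    (D₂ : W₂.SelmerDualData κ γ) : D₂.IsTorsion ∧ D₂.mu = 0 :=
  selmer_isTorsion_and_mu_eq_zero_of_natCard_eq κ S₀ hκ hγ
    (ClassX3Gord.natCard_torsionBy_nonPrimitiveSelmerInfty_eq κ S₀ hGrK hp2 hκ hX₁ he₁ hX₂ he₂ htors₁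
      hS₀ hS₁ hS₂ hT) DS₁ ht₁ hμ₁ D₂

end Gord

end Summit.BirchSwinnertonDyer.Rank1Residual.Additive

namespace Summit.BirchSwinnertonDyer.Rank1Residual.AdditivePotMult

open Summit.BirchSwinnertonDyer.Rank1Residual.Additive
open Summit.BirchSwinnertonDyer.Rank1Residual.X1.CongruenceTransfer (TorsionIso)

section PotMultPairs

variable {p : ℕ} [hp : Fact p.Prime] {W₁ W₂ : WeierstrassCurve ℚ} [W₁.IsElliptic] [W₂.IsElliptic]
  (κ : ZpExtension ℚ p) {γ : absoluteGaloisGroup ℚ} (S₀ : Set (HeightOneSpectrum (𝓞 ℚ)))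

/-- **X4(M) pairs, every odd `p`: `Sel_{p^∞}(E₂/ℚ_∞)` is `Λ`-cotorsion with `μ = 0`** (every dual
datum) as soon as a f.g. non-primitive dual of the partner `E₁` is torsion with `μ = 0`; mod A40/A41.
X4(M) stays CONSTRUCTION-SHAPED; nothing booked. [cite: GreenbergVatsal2000, §2 Prop. (2.8) and pp. 26–27]
[cite: SilvermanATAEC1994, Ch. V Thm. 5.3, Cor. 5.4] -/
theorem ClassX4M.selmer_isTorsion_and_mu_eq_zero_of_torsionIso
    (hT40 : Silverman1994_thmV53_tateUniformisation.{0})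
    (hT41 : Silverman1994_thmV53_corV54_tateUniformisation.{0}) (hκ : κ.IsCyclotomic)
    (hγ : κ.IsTopGenerator γ) (hX₁ : ClassX4M W₁ p) (hX₂ : ClassX4M W₂ p)
    (hS₀ : ∀ v ∈ S₀, ((p : ℕ) : 𝓞 ℚ) ∉ v.asIdeal)
    (hS₁ : ∀ v : HeightOneSpectrum (𝓞 ℚ), v ∉ S₀ → ((p : ℕ) : 𝓞 ℚ) ∉ v.asIdeal →
      W₁.HasGoodReductionAt v)
    (hS₂ : ∀ v : HeightOneSpectrum (𝓞 ℚ), v ∉ S₀ → ((p : ℕ) : 𝓞 ℚ) ∉ v.asIdeal →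
      W₂.HasGoodReductionAt v)
    (hT : TorsionIso W₁ W₂ p)
    (DS₁ : NonPrimitiveDualData W₁ κ γ S₀) [Module.Finite (IwasawaAlgebra p) DS₁.X]
    (ht₁ : Module.IsTorsion (IwasawaAlgebra p) DS₁.X) (hμ₁ : muInvariant p DS₁.X = 0)
    (D₂ : W₂.SelmerDualData κ γ) : D₂.IsTorsion ∧ D₂.mu = 0 :=
  selmer_isTorsion_and_mu_eq_zero_of_natCard_eq κ S₀ hκ hγ
    (ClassX4M.natCard_torsionBy_nonPrimitiveSelmerInfty_eq κ S₀ hT40 hT41 hκ hX₁ hX₂ hS₀ hS₁ hS₂ hT)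
    DS₁ ht₁ hμ₁ D₂

/-- **X3♯(M) pairs, odd `p` (REDUCIBLE `E_i[p]`): the same**, census bit `p ∤ #E₁(ℚ)_tors`; mod
A40/A41. X3♯(M) stays as labelled; nothing booked. [cite: GreenbergVatsal2000, §2 Prop. (2.8) and pp. 26–27]
[cite: SilvermanATAEC1994, Ch. V Thm. 5.3, Cor. 5.4] -/
theorem ClassX3M.selmer_isTorsion_and_mu_eq_zero_of_torsionIso [W₁.IsGloballyMinimal]
    [W₂.IsGloballyMinimal] (hT40 : Silverman1994_thmV53_tateUniformisation.{0})
    (hT41 : Silverman1994_thmV53_corV54_tateUniformisation.{0}) (hκ : κ.IsCyclotomic)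
    (hγ : κ.IsTopGenerator γ) (hX₁ : ClassX3M W₁ p) (hX₂ : ClassX3M W₂ p)
    (htors₁ : ¬ p ∣ W₁.torsionOrder)
    (hS₀ : ∀ v ∈ S₀, ((p : ℕ) : 𝓞 ℚ) ∉ v.asIdeal)
    (hS₁ : ∀ v : HeightOneSpectrum (𝓞 ℚ), v ∉ S₀ → ((p : ℕ) : 𝓞 ℚ) ∉ v.asIdeal →
      W₁.HasGoodReductionAt v)
    (hS₂ : ∀ v : HeightOneSpectrum (𝓞 ℚ), v ∉ S₀ → ((p : ℕ) : 𝓞 ℚ) ∉ v.asIdeal →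
      W₂.HasGoodReductionAt v)
    (hT : TorsionIso W₁ W₂ p)
    (DS₁ : NonPrimitiveDualData W₁ κ γ S₀) [Module.Finite (IwasawaAlgebra p) DS₁.X]
    (ht₁ : Module.IsTorsion (IwasawaAlgebra p) DS₁.X) (hμ₁ : muInvariant p DS₁.X = 0)
    (D₂ : W₂.SelmerDualData κ γ) : D₂.IsTorsion ∧ D₂.mu = 0 :=
  selmer_isTorsion_and_mu_eq_zero_of_natCard_eq κ S₀ hκ hγ
    (ClassX3M.natCard_torsionBy_nonPrimitiveSelmerInfty_eq κ S₀ hT40 hT41 hκ hX₁ hX₂ htors₁ hS₀ hS₁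
      hS₂ hT) DS₁ ht₁ hμ₁ D₂

end PotMultPairs

section Mixed

variable {p : ℕ} [hp : Fact p.Prime] {W₁ W₂ : WeierstrassCurve ℚ} [W₁.IsElliptic]
  [W₁.IsGloballyMinimal] [W₂.IsElliptic] (κ : ZpExtension ℚ p) {γ : absoluteGaloisGroup ℚ}
  (S₀ : Set (HeightOneSpectrum (𝓞 ℚ)))

/-- **X4♯(G-ord, `e = 2`) × X4(M), every odd `p`: the (M) partner's `Sel_{p^∞}(E₂/ℚ_∞)` is
`Λ`-cotorsion with `μ = 0`** (every dual datum), given a f.g. torsion non-primitive dual of the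
(G-ord) curve with `μ = 0`; mod `hGrK` / A40–A41. Nothing booked.
[cite: GreenbergVatsal2000, §2 Prop. (2.8) and pp. 26–27] [cite: SilvermanATAEC1994, Ch. V Thm. 5.3, Cor. 5.4] -/
theorem ClassX4M.selmer_isTorsion_and_mu_eq_zero_of_classX4Gord
    (hGrK : imKummer_ge_strictCondition_goodOrdinary)
    (hT40 : Silverman1994_thmV53_tateUniformisation.{0})
    (hT41 : Silverman1994_thmV53_corV54_tateUniformisation.{0}) (hκ : κ.IsCyclotomic)
    (hγ : κ.IsTopGenerator γ)
    (hX₁ : ClassX4Gord W₁ p) (he₁ : semistabilityIndex W₁ p = 2) (hX₂ : ClassX4M W₂ p)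
    (hS₀ : ∀ v ∈ S₀, ((p : ℕ) : 𝓞 ℚ) ∉ v.asIdeal)
    (hS₁ : ∀ v : HeightOneSpectrum (𝓞 ℚ), v ∉ S₀ → ((p : ℕ) : 𝓞 ℚ) ∉ v.asIdeal →
      W₁.HasGoodReductionAt v)
    (hS₂ : ∀ v : HeightOneSpectrum (𝓞 ℚ), v ∉ S₀ → ((p : ℕ) : 𝓞 ℚ) ∉ v.asIdeal →
      W₂.HasGoodReductionAt v)
    (hT : TorsionIso W₁ W₂ p)
    (DS₁ : NonPrimitiveDualData W₁ κ γ S₀) [Module.Finite (IwasawaAlgebra p) DS₁.X]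
    (ht₁ : Module.IsTorsion (IwasawaAlgebra p) DS₁.X) (hμ₁ : muInvariant p DS₁.X = 0)
    (D₂ : W₂.SelmerDualData κ γ) : D₂.IsTorsion ∧ D₂.mu = 0 :=
  selmer_isTorsion_and_mu_eq_zero_of_natCard_eq κ S₀ hκ hγ
    (ClassX4M.natCard_torsionBy_nonPrimitiveSelmerInfty_eq_of_classX4Gord κ S₀ hGrK hT40 hT41 hκ hX₁
      he₁ hX₂ hS₀ hS₁ hS₂ hT) DS₁ ht₁ hμ₁ D₂

/-- **X3♯(G-ord, `e = 2`) × X3♯(M), odd `p`: the (M) partner's `Sel_{p^∞}(E₂/ℚ_∞)` is `Λ`-cotorsion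
with `μ = 0`** (every dual datum; census bit `p ∤ #E₁(ℚ)_tors`), mod `hGrK` / A40–A41. Nothing booked.
[cite: GreenbergVatsal2000, §2 Prop. (2.8) and pp. 26–27] [cite: SilvermanATAEC1994, Ch. V Thm. 5.3, Cor. 5.4] -/
theorem ClassX3M.selmer_isTorsion_and_mu_eq_zero_of_classX3Gord [W₂.IsGloballyMinimal]
    (hGrK : imKummer_ge_strictCondition_goodOrdinary)
    (hT40 : Silverman1994_thmV53_tateUniformisation.{0})
    (hT41 : Silverman1994_thmV53_corV54_tateUniformisation.{0}) (hp2 : p ≠ 2) (hκ : κ.IsCyclotomic)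
    (hγ : κ.IsTopGenerator γ)
    (hX₁ : ClassX3Gord W₁ p) (he₁ : semistabilityIndex W₁ p = 2) (hX₂ : ClassX3M W₂ p)
    (htors₁ : ¬ p ∣ W₁.torsionOrder)
    (hS₀ : ∀ v ∈ S₀, ((p : ℕ) : 𝓞 ℚ) ∉ v.asIdeal)
    (hS₁ : ∀ v : HeightOneSpectrum (𝓞 ℚ), v ∉ S₀ → ((p : ℕ) : 𝓞 ℚ) ∉ v.asIdeal →
      W₁.HasGoodReductionAt v)
    (hS₂ : ∀ v : HeightOneSpectrum (𝓞 ℚ), v ∉ S₀ → ((p : ℕ) : 𝓞 ℚ) ∉ v.asIdeal →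
      W₂.HasGoodReductionAt v)
    (hT : TorsionIso W₁ W₂ p)
    (DS₁ : NonPrimitiveDualData W₁ κ γ S₀) [Module.Finite (IwasawaAlgebra p) DS₁.X]
    (ht₁ : Module.IsTorsion (IwasawaAlgebra p) DS₁.X) (hμ₁ : muInvariant p DS₁.X = 0)
    (D₂ : W₂.SelmerDualData κ γ) : D₂.IsTorsion ∧ D₂.mu = 0 :=
  selmer_isTorsion_and_mu_eq_zero_of_natCard_eq κ S₀ hκ hγ
    (ClassX3M.natCard_torsionBy_nonPrimitiveSelmerInfty_eq_of_classX3Gord κ S₀ hGrK hT40 hT41 hp2 hκ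
      hX₁ he₁ hX₂ htors₁ hS₀ hS₁ hS₂ hT) DS₁ ht₁ hμ₁ D₂

end Mixed

end Summit.BirchSwinnertonDyer.Rank1Residual.AdditivePotMult

end
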